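import Literature.Analysis.ValidatedNumerics.MultiPrecisionInterval
import HarnessLib

/-!
# Kernel-checked enclosures of finite exponential sums `Σ cᵢ · e^{qᵢ}` (`cᵢ, qᵢ ∈ ℚ`)

Topic `Literature/Analysis/ValidatedNumerics`: a generic certificate checker in the style of this
directory (`KernelData.lean`, `SymmetricEigenCertificate.lean`, …), built on the multi-precision
interval engine `MultiPrecisionInterval.lean` (`NumericsMP.MI`, membership `MI.mem S x I` at a binary
scale `S`).  A finite sum `Σ_i c_i e^{q_i}` with rational coefficients `c_i` and rational exponents
`q_i` — an element of the group ring `ℚ[e^ℚ]`, typically with enormous cancellation between its terms —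
is given as LITERAL DATA (a list of `ETerm`s); `esum L` is its real value, and the closed Boolean terms
`checkLB` / `checkUB` / `checkEncl`, evaluated by the kernel (`decide +kernel`), PROVE
`bn/bd ≤ esum L`, `esum L ≤ bn/bd`, resp. a two-sided enclosure, through the soundness theorems below.
Every term is evaluated in outward-rounded fixed-point interval arithmetic at a caller-chosen scale
`S = 2^P`, with `K` Taylor terms and `k` argument halvings for `exp` (`MI.expPt S K k`); all
recursions are structural (lists), so that kernel evaluation is fast.

Origin: written for the exact main terms of the DHL[42,2] certificate (sums of 113 and 23 terms whose
single terms reach `10^1180` while the sums are `≈ 10^10`; scale `P ≈ 4200`), where it was the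
package file `Dhl42/Numerics/ExpSum.lean` over an abridged copy of `MultiPrecisionInterval.lean`; here
it is re-pointed to the tree's engine (the data-level definitions are character-identical, so kernel
reductions are unchanged) and states no number theory.

## Main definitions (namespace `Literature.Analysis.ValidatedNumerics.ExpSum`)

* `ETerm` — a term `⟨cn, cd, qn, qd⟩` standing for `(cn/cd) · exp (qn/qd)`; `ETerm.val`.
* `esum L` — the real number `Σ_{t ∈ L} t.val`.
* `ETerm.encl`, `enclSum S K k L : Option MI` — interval enclosures; `wf L` (denominators positive).
* `checkLB S K k L bn bd`, `checkUB S K k L bn bd`, `checkEncl S K k L ln ld un ud : Bool`.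

## Main results

* `ETerm.mem_encl`, `mem_enclSum` — `esum L ∈ enclSum S K k L` (inclusion property).
* `le_esum_of_checkLB : checkLB S K k L bn bd = true → bn/bd ≤ esum L` (for `0 < S`, `0 < bd`),
  `esum_le_of_checkUB : checkUB S K k L bn bd = true → esum L ≤ bn/bd`,
  `bounds_of_checkEncl : checkEncl S K k L ln ld un ud = true → ln/ld ≤ esum L ∧ esum L ≤ un/ud`,
  and `bounds_of_checkEncl'` with the positivity side conditions as Boolean equations.

NOT here: any particular certificate (the data lists and their `decide +kernel` checks live with
their users); complex exponents; a completeness statement (a `false` checker proves nothing).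

## References

* R. E. Moore, *Interval Analysis*, Prentice-Hall 1966, Ch. 2–3 (inclusion property, outward
  rounding) — the discipline of `MI`; the checkers are its routine application. [folklore]
-/

open Real

namespace Literature.Analysis.ValidatedNumerics.ExpSum

open NumericsMP

/-- A term `(cn/cd) · e^{qn/qd}` of an exponential sum (`cd, qd > 0` intended, see `wf`; for `cd = 0` or
`qd = 0` the value is Lean's junk `x / 0 = 0`, and such lists are rejected by every checker). [folklore] -/
structure ETerm where
  /-- numerator of the coefficient -/
  cn : ℤ
  /-- denominator of the coefficient -/
  cd : ℕ
  /-- numerator of the exponent -/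
  qn : ℤ
  /-- denominator of the exponent -/
  qd : ℕ
  deriving DecidableEq, Repr, Inhabited

namespace ETerm

/-- The real value `(cn/cd) · exp (qn/qd)` of a term. [folklore] -/
noncomputable def val (t : ETerm) : ℝ := (t.cn : ℝ) / t.cd * Real.exp ((t.qn : ℝ) / t.qd)

/-- Interval enclosure of a term at scale `S`: `exp` by `MI.expPt S K k` on the (at most one ulp
wide) enclosure of `qn/qd`, then exact multiplication by `cn` and outward division by `cd`
(`none` if the `exp` enclosure fails its range check). [folklore] -/
def encl (S K k : ℕ) (t : ETerm) : Option MI :=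
  match MI.expPt S K k (MI.ofFrac S t.qn t.qd) with
  | some Y => some ((Y.mulInt t.cn).divNat t.cd)
  | none => none

variable {S K k : ℕ}

/-- Inclusion property of `ETerm.encl`: the value of a term with positive denominators lies in its
enclosure (Moore's inclusion principle through `MI.mem_expPt`, `mem_mulInt`, `mem_divNat`). [folklore] -/
theorem mem_encl (hS : 0 < S) (t : ETerm) (hcd : 0 < t.cd) (hqd : 0 < t.qd) {Y : MI}
    (h : t.encl S K k = some Y) : MI.mem S t.val Y := by
  unfold encl at h
  split at h
  · rename_i Z hZ
    simp only [Option.some.injEq] at h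
    subst h
    have h1 : MI.mem S (Real.exp ((t.qn : ℝ) / t.qd)) Z :=
      MI.mem_expPt hS hZ (MI.mem_ofFrac S t.qn hqd)
    have h2 := MI.mem_divNat (MI.mem_mulInt h1 t.cn) hcd
    convert h2 using 1
    unfold val
    ring
  · simp at h

end ETerm

/-- The real number `Σ_{t ∈ L} (t.cn/t.cd) · e^{t.qn/t.qd}` (structural recursion on the list). [folklore] -/
noncomputable def esum : List ETerm → ℝ
  | [] => 0
  | t :: ts => t.val + esum ts

/-- Interval enclosure of `esum L` (structural recursion, so that the kernel evaluates it; `none` if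
some `exp` enclosure fails). [folklore] -/
def enclSum (S K k : ℕ) : List ETerm → Option MI
  | [] => some ⟨0, 0⟩
  | t :: ts =>
    match t.encl S K k, enclSum S K k ts with
    | some A, some B => some (A.add B)
    | _, _ => none

/-- All denominators of the list are positive (the well-formedness test every checker performs). [folklore] -/
def wf (L : List ETerm) : Bool := L.all fun t => decide (0 < t.cd) && decide (0 < t.qd)

variable {S K k : ℕ}

/-- Inclusion property of `enclSum`: for a list with positive denominators, `esum L ∈ enclSum S K k L`
(induction on the list, `MI.mem_add`). [folklore] -/
theorem mem_enclSum (hS : 0 < S) :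
    ∀ (L : List ETerm), (∀ t ∈ L, 0 < t.cd ∧ 0 < t.qd) →
      ∀ {Y : MI}, enclSum S K k L = some Y → MI.mem S (esum L) Y
  | [], _, Y, h => by
    simp only [enclSum, Option.some.injEq] at h
    subst h
    simp [MI.mem, esum]
  | t :: ts, hL, Y, h => by
    simp only [enclSum] at h
    split at h
    · rename_i A B hA hB
      simp only [Option.some.injEq] at h
      subst h
      have ht := hL t (by simp)
      have h1 := ETerm.mem_encl hS t ht.1 ht.2 hA
      have h2 := mem_enclSum hS ts (fun u hu => hL u (by simp [hu])) hB
      simpa [esum] using MI.mem_add h1 h2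
    · simp at h

/-- `wf L = true` unfolds to: every term has positive denominators. [folklore] -/
lemma wf_spec {L : List ETerm} (h : wf L = true) : ∀ t ∈ L, 0 < t.cd ∧ 0 < t.qd := by
  intro t ht
  unfold wf at h
  rw [List.all_eq_true] at h
  simpa using h t ht

/-- Boolean checker for a lower bound `bn/bd ≤ esum L`: well-formedness, then `bn·S ≤ lo·bd` for the
enclosure `⟨lo, hi⟩` of the sum. [folklore] -/
def checkLB (S K k : ℕ) (L : List ETerm) (bn : ℤ) (bd : ℕ) : Bool :=
  wf L &&
    match enclSum S K k L with
    | some Y => decide (bn * (S : ℤ) ≤ Y.lo * bd)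
    | none => false

/-- Boolean checker for an upper bound `esum L ≤ bn/bd`: well-formedness, then `hi·bd ≤ bn·S`. [folklore] -/
def checkUB (S K k : ℕ) (L : List ETerm) (bn : ℤ) (bd : ℕ) : Bool :=
  wf L &&
    match enclSum S K k L with
    | some Y => decide (Y.hi * bd ≤ bn * (S : ℤ))
    | none => false

/-- Soundness of `checkLB` (`0 < S`, `0 < bd`): `checkLB S K k L bn bd = true → bn/bd ≤ esum L`. [folklore] -/
theorem le_esum_of_checkLB (hS : 0 < S) {L : List ETerm} {bn : ℤ} {bd : ℕ} (hbd : 0 < bd)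
    (h : checkLB S K k L bn bd = true) : (bn : ℝ) / bd ≤ esum L := by
  unfold checkLB at h
  rw [Bool.and_eq_true] at h
  obtain ⟨hwf, h⟩ := h
  have hL := wf_spec hwf
  split at h
  · rename_i Y hY
    have hm := (mem_enclSum hS L hL hY).1
    have h' : bn * (S : ℤ) ≤ Y.lo * bd := of_decide_eq_true h
    have h'' : (bn : ℝ) * S ≤ Y.lo * bd := by exact_mod_cast h'
    have hSr : (0 : ℝ) < S := by exact_mod_cast hS
    have hbdr : (0 : ℝ) < bd := by exact_mod_cast hbd
    rw [div_le_iff₀ hbdr]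
    nlinarith [mul_le_mul_of_nonneg_right hm hbdr.le]
  · simp at h

/-- Soundness of `checkUB` (`0 < S`, `0 < bd`): `checkUB S K k L bn bd = true → esum L ≤ bn/bd`. [folklore] -/
theorem esum_le_of_checkUB (hS : 0 < S) {L : List ETerm} {bn : ℤ} {bd : ℕ} (hbd : 0 < bd)
    (h : checkUB S K k L bn bd = true) : esum L ≤ (bn : ℝ) / bd := by
  unfold checkUB at h
  rw [Bool.and_eq_true] at h
  obtain ⟨hwf, h⟩ := h
  have hL := wf_spec hwf
  split at h
  · rename_i Y hY
    have hm := (mem_enclSum hS L hL hY).2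
    have h' : Y.hi * bd ≤ bn * (S : ℤ) := of_decide_eq_true h
    have h'' : (Y.hi : ℝ) * bd ≤ bn * S := by exact_mod_cast h'
    have hSr : (0 : ℝ) < S := by exact_mod_cast hS
    have hbdr : (0 : ℝ) < bd := by exact_mod_cast hbd
    rw [le_div_iff₀ hbdr]
    nlinarith [mul_le_mul_of_nonneg_right hm hbdr.le]
  · simp at h

/-- Combined Boolean checker for `ln/ld ≤ esum L ≤ un/ud` from ONE enclosure of the sum. [folklore] -/
def checkEncl (S K k : ℕ) (L : List ETerm) (ln : ℤ) (ld : ℕ) (un : ℤ) (ud : ℕ) : Bool :=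
  wf L &&
    match enclSum S K k L with
    | some Y => decide (ln * (S : ℤ) ≤ Y.lo * ld) && decide (Y.hi * ud ≤ un * (S : ℤ))
    | none => false

/-- Soundness of `checkEncl` (`0 < S`, `0 < ld`, `0 < ud`):
`checkEncl S K k L ln ld un ud = true → ln/ld ≤ esum L ∧ esum L ≤ un/ud`. [folklore] -/
theorem bounds_of_checkEncl (hS : 0 < S) {L : List ETerm} {ln un : ℤ} {ld ud : ℕ}
    (hld : 0 < ld) (hud : 0 < ud) (h : checkEncl S K k L ln ld un ud = true) :
    (ln : ℝ) / ld ≤ esum L ∧ esum L ≤ (un : ℝ) / ud := by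
  unfold checkEncl at h
  rw [Bool.and_eq_true] at h
  obtain ⟨hwf, h⟩ := h
  have hL := wf_spec hwf
  split at h
  · rename_i Y hY
    rw [Bool.and_eq_true] at h
    have hm := mem_enclSum hS L hL hY
    have h1 : ln * (S : ℤ) ≤ Y.lo * ld := of_decide_eq_true h.1
    have h2 : Y.hi * ud ≤ un * (S : ℤ) := of_decide_eq_true h.2
    have h1' : (ln : ℝ) * S ≤ Y.lo * ld := by exact_mod_cast h1
    have h2' : (Y.hi : ℝ) * ud ≤ un * S := by exact_mod_cast h2
    have hSr : (0 : ℝ) < S := by exact_mod_cast hS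
    have hldr : (0 : ℝ) < ld := by exact_mod_cast hld
    have hudr : (0 : ℝ) < ud := by exact_mod_cast hud
    constructor
    · rw [div_le_iff₀ hldr]
      nlinarith [mul_le_mul_of_nonneg_right hm.1 hldr.le]
    · rw [le_div_iff₀ hudr]
      nlinarith [mul_le_mul_of_nonneg_right hm.2 hudr.le]
  · simp at h

/-- The scale must be positive for the checkers to mean anything; this is itself decidable, so a
certificate can discharge it by `decide` as well (all four hypotheses are closed Boolean equations). [folklore] -/
theorem bounds_of_checkEncl' {L : List ETerm} {ln un : ℤ} {ld ud : ℕ}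
    (hS : Nat.blt 0 S = true) (hld : Nat.blt 0 ld = true) (hud : Nat.blt 0 ud = true)
    (h : checkEncl S K k L ln ld un ud = true) :
    (ln : ℝ) / ld ≤ esum L ∧ esum L ≤ (un : ℝ) / ud :=
  bounds_of_checkEncl (by simpa using hS) (by simpa using hld) (by simpa using hud) h

end Literature.Analysis.ValidatedNumerics.ExpSum
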